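import Mathlib
import Summits.ValiantsHypothesis.ValiantsHypothesis.Theorems.BarrierLeverPartitionMinorsHitByVPSimplexJoinTwoSlotsLevels
import Summits.ValiantsHypothesis.ValiantsHypothesis.Theorems.BarrierLeverPartitionMinorsHitByVPHiddenStatesUniversalConstraints

/-!
# Route BarrierLever — item `PartitionMinorsHitByVP` (19717): `Stmt.pieceKill`, shallow pattern (2,0)
Helper file (`--supports stmt-ValiantsHypothesis-19717`; cell valiant-natproofs, 𝒟-side door (c), line `hidden_states`, uniform-menu
lane; prover seat val-np-p3 gen 12). Definition-free; closes NO item. First SHALLOW case of the case map toward `Stmt.pieceKill H₀`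
(memo val-np-p3 g12 §2(g), pattern (P3)), as the template for the remaining patterns: a one-piece exact-support design with a WIDE slot
`f₁` (`|S 0 f₁| ≥ 1 + h + C(h,2)`, i.e. level 2 at `A = univ`, and `≤ (2h)²`) and a NARROW slot `f₂` (`1 ≤ |S 0 f₂| ≤ h`, level 0), and
`n = (|S 0 f₁|+1)(|S 0 f₂|+1)` columns (all other slots dead), is defeated for every table (`pieceKill_pattern20`, `h ≥ 2^20`):
* `4·s₂ ≤ h`: the two-slot RANK form at `A = univ`, levels (2,0), rows = the `n` smallest sets (`rowsSmallFirst h 4`): either all rows have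
  size `≤ 3`, or `C(h,≤3)` of them do and the deficit `(s₁+1−C(h,≤2))·s₂` covers the rest (`arith20_narrow`);
* `4·s₂ > h`: levels (2,1) inside `|A| = s₂ − 1` coordinates, rows = `n` sets of size `≤ 4` inside `A` (`24·n ≤ (s₂−4)⁴ ≤ 24·C(s₂−1,4)`,
  `arith20_wide`), deficit `≥ 1`.
Tools: `det_eq_zero_of_two_slots_levels_rank` (p629996), `UniversalConstraints.rowsSmallFirst` (g6).
Nothing on crux 14610 or VP ≠ VNP; item 19717 stays OPEN.
-/

set_option linter.dupNamespace false

namespace Summit.ValiantsHypothesis.ValiantsHypothesis.Theorems.BarrierLever.SimplexJoin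

open Finset Matrix
open Summit.ValiantsHypothesis.ValiantsHypothesis.Theorems.BarrierLever.HiddenStates.UniversalConstraints
  (rowsSmallFirst rowsSmallFirst_injective card_small_rowsSmallFirst)

/-- Arithmetic of the narrow sub-case: `4h²+2 + C(h,≤2)·(s₂ − 1) < C(h,3)` in the form the rank lemma wants. -/
theorem arith20_narrow (h s₁ s₂ : ℕ) (hh : 200 ≤ h)
    (hs₁ : ∑ i ∈ Finset.range 3, h.choose i ≤ s₁) (hs₁N : s₁ ≤ (h + h) ^ 2) (h4 : 4 * s₂ ≤ h) :
    (s₁ + 1) * (s₂ + 1) < ∑ i ∈ Finset.range 4, h.choose i +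
      (s₁ + 1 - ∑ i ∈ Finset.range 3, h.choose i) * (s₂ + 1 - ∑ i ∈ Finset.range 1, h.choose i) := by
  obtain ⟨k, rfl⟩ : ∃ k, h = k + 2 := ⟨h - 2, by omega⟩
  have hP2 : 2 * (k + 2).choose 2 = (k + 1) * (k + 2) := by
    have h1 := Nat.descFactorial_eq_factorial_mul_choose (k + 2) 2
    have h2 : (k + 2).descFactorial 2 = (k + 1) * (k + 2) := by simp [Nat.descFactorial_succ]
    simp only [Nat.factorial_two] at h1
    omega
  have hP3 : 6 * (k + 2).choose 3 = k * (k + 1) * (k + 2) := by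
    have h1 := Nat.descFactorial_eq_factorial_mul_choose (k + 2) 3
    have h2 : (k + 2).descFactorial 3 = k * (k + 1) * (k + 2) := by
      simp [Nat.descFactorial_succ]; ring
    rw [h2, show Nat.factorial 3 = 6 by rfl] at h1
    omega
  simp only [Finset.sum_range_succ, Finset.sum_range_zero, Nat.choose_zero_right, Nat.choose_one_right, zero_add] at hs₁ ⊢
  set P2 := (k + 2).choose 2 with hP2def
  set P3 := (k + 2).choose 3 with hP3def
  set x := s₁ + 1 - (1 + (k + 2) + P2) with hx
  have hxs : s₁ + 1 = x + (1 + (k + 2) + P2) := by omega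
  have hs2' : s₂ + 1 - 1 = s₂ := by omega
  rw [hs2', hxs]
  have hxle : x ≤ 4 * (k + 2) ^ 2 := by nlinarith
  have F1 : 4 * s₂ * ((k + 1) * (k + 2)) ≤ (k + 2) * ((k + 1) * (k + 2)) := Nat.mul_le_mul_right _ h4
  have F2 : 4 * s₂ * (k + 3) ≤ (k + 2) * (k + 3) := Nat.mul_le_mul_right _ h4
  have F4 : 198 * k ≤ k * k := Nat.mul_le_mul_right _ (by omega)
  have F5 : 198 * (k * k) ≤ k * (k * k) := Nat.mul_le_mul_right _ (by omega)
  nlinarith [F1, F2, F4, F5, hxle, h4]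

/-- Arithmetic of the wide sub-case: `24·(s₁+1)(s₂+1) ≤ (s₂ − 4)⁴`. -/
theorem arith20_wide (h s₁ s₂ : ℕ) (hh : 2 ^ 20 ≤ h) (hs₁N : s₁ ≤ (h + h) ^ 2) (hs₂h : s₂ ≤ h) (h4 : h + 1 ≤ 4 * s₂) :
    24 * ((s₁ + 1) * (s₂ + 1)) ≤ (s₂ - 4) ^ 4 := by
  obtain ⟨b, rfl⟩ : ∃ b, s₂ = b + 4 := ⟨s₂ - 4, by omega⟩
  have hb : h ≤ 8 * b := by omega
  have hb2 : 12336 ≤ b := by omega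
  have hhb : h * h ≤ 8 * b * (8 * b) := Nat.mul_le_mul hb hb
  have hs1b : s₁ + 1 ≤ 256 * (b * b) + 1 := by nlinarith
  have G1 : (s₁ + 1) * (b + 5) ≤ (256 * (b * b) + 1) * (b + 5) := Nat.mul_le_mul_right _ hs1b
  have G2 : 12336 * (b * (b * b)) ≤ b * (b * (b * b)) := Nat.mul_le_mul_right _ hb2
  have G3 : 12336 * (b * b) ≤ b * (b * b) := Nat.mul_le_mul_right _ hb2
  have G4 : 12336 * b ≤ b * b := Nat.mul_le_mul_right _ hb2
  rw [show b + 4 - 4 = b by omega, show b + 4 + 1 = b + 5 by rfl]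
  nlinarith [G1, G2, G3, G4]

/-- Arithmetic for `n ≤ 2^h`: `24·(s₁+1)(s₂+1) ≤ (h − 3)⁴ (≤ 24·C(h,4))`. -/
theorem arith20_pow (h s₁ s₂ : ℕ) (hh : 2 ^ 20 ≤ h) (hs₁N : s₁ ≤ (h + h) ^ 2) (hs₂h : s₂ ≤ h) :
    24 * ((s₁ + 1) * (s₂ + 1)) ≤ (h - 3) ^ 4 := by
  obtain ⟨c, rfl⟩ : ∃ c, h = c + 3 := ⟨h - 3, by omega⟩
  have hc : 1000 ≤ c := by omega
  have G1 : (s₁ + 1) * (s₂ + 1) ≤ (4 * (c + 3) ^ 2 + 1) * (c + 4) :=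
    Nat.mul_le_mul (by nlinarith) (by omega)
  have G2 : 1000 * (c * (c * c)) ≤ c * (c * (c * c)) := Nat.mul_le_mul_right _ hc
  have G3 : 1000 * (c * c) ≤ c * (c * c) := Nat.mul_le_mul_right _ hc
  have G4 : 1000 * c ≤ c * c := Nat.mul_le_mul_right _ hc
  rw [show c + 3 - 3 = c by omega]
  nlinarith [G1, G2, G3, G4]

/-- **Pattern (2,0) of `Stmt.pieceKill`.** A one-piece exact-support design with a wide slot (level 2 at `univ`, `≤ (2h)²` options), a
narrow slot (`1 ≤ · ≤ h` options) and `n = (s₁+1)(s₂+1)` columns has an injective row family on which every table is singular (`h ≥ 2^20`). -/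
theorem pieceKill_pattern20 (h D N n : ℕ) (hh : 2 ^ 20 ≤ h) (S : Fin 1 → Fin D → Finset (Fin N))
    (e : Fin n → Fin 1 × (Fin D → Option (Fin N))) (he : Function.Injective e)
    (hlive : ∀ c : Fin 1 × (Fin D → Option (Fin N)),
      c ∈ Set.range e ↔ ∀ (f : Fin D) (j : Fin N), c.2 f = some j → j ∈ S c.1 f)
    (f₁ f₂ : Fin D) (hf : f₁ ≠ f₂)
    (hs₁ : ∑ i ∈ Finset.range 3, h.choose i ≤ (S 0 f₁).card) (hs₁N : (S 0 f₁).card ≤ (h + h) ^ 2)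
    (hs₂ : 1 ≤ (S 0 f₂).card) (hs₂h : (S 0 f₂).card ≤ h)
    (hn : n = ((S 0 f₁).card + 1) * ((S 0 f₂).card + 1)) :
    ∃ v : Fin n → Finset (Fin h), Function.Injective v ∧
      ∀ T : Fin 1 → Option (Fin D × Fin N) → Fin h → ℂ,
        (Matrix.of fun x x' : Fin n => ∏ a ∈ v x,
          (T (e x').1 none a + ∑ f : Fin D, ((e x').2 f).elim 0 fun j => T (e x').1 (some (f, j)) a)).det = 0 := by
  classical
  set s₁ := (S 0 f₁).card with hs₁def
  set s₂ := (S 0 f₂).card with hs₂def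
  -- `n ≤ 2^h`
  have hn2 : n ≤ 2 ^ h := by
    have h1 := Nat.pow_sub_le_descFactorial h 4
    rw [Nat.descFactorial_eq_factorial_mul_choose, show Nat.factorial 4 = 24 by rfl,
      show h + 1 - 4 = h - 3 by omega] at h1
    have h2 := (arith20_pow h s₁ s₂ hh hs₁N hs₂h).trans h1
    have h3 := Nat.choose_le_two_pow h 4
    rw [hn]
    omega
  by_cases h4 : 4 * s₂ ≤ h
  · -- NARROW: rank form at `A = univ`, levels (2,0), the `n` smallest rows
    refine ⟨rowsSmallFirst h 4 n hn2, rowsSmallFirst_injective h 4 n hn2, fun T => ?_⟩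
    refine det_eq_zero_of_two_slots_levels_rank h 2 0 1 D N n Finset.univ (rowsSmallFirst h 4 n hn2) S e he hlive 0 f₁ f₂ hf
      ?_ T
    have hsmall := card_small_rowsSmallFirst h 4 n hn2
    have hsub : (Finset.univ.filter fun i : Fin n => (rowsSmallFirst h 4 n hn2 i).card < 4) ⊆
        (Finset.univ.filter fun i : Fin n => rowsSmallFirst h 4 n hn2 i ⊆ Finset.univ ∧
          (rowsSmallFirst h 4 n hn2 i).card ≤ 2 + 0 + 1) := by
      intro i hi
      simp only [Finset.mem_filter, Finset.mem_univ, true_and, Finset.subset_univ] at hi ⊢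
      omega
    have hcard := Finset.card_le_card hsub
    simp only [Finset.card_univ, Fintype.card_fin]
    have harith := arith20_narrow h s₁ s₂ (by omega) hs₁ hs₁N h4
    have hx : 1 ≤ (s₁ + 1 - ∑ i ∈ Finset.range 3, h.choose i) * (s₂ + 1 - ∑ i ∈ Finset.range 1, h.choose i) := by
      have h1 : 1 ≤ s₁ + 1 - ∑ i ∈ Finset.range 3, h.choose i := by omega
      have h2 : 1 ≤ s₂ + 1 - ∑ i ∈ Finset.range 1, h.choose i := by simp; omega
      exact Nat.one_le_iff_ne_zero.mpr (Nat.mul_ne_zero (by omega) (by omega))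
    rcases le_total n (∑ i ∈ Finset.range 4, h.choose i) with hle | hle
    · rw [min_eq_left hle] at hsmall
      calc n < n + 1 := Nat.lt_succ_self _
        _ ≤ _ := Nat.add_le_add (hsmall.trans hcard) hx
    · rw [min_eq_right hle] at hsmall
      calc n = (s₁ + 1) * (s₂ + 1) := hn
        _ < _ := harith
        _ ≤ _ := Nat.add_le_add_right (hsmall.trans hcard) _
  · -- WIDE second slot: levels (2,1) inside `a = s₂ - 1` coordinates
    push Not at h4
    set a := s₂ - 1 with hadef
    have ha : a ≤ h := by omega
    have hwide := arith20_wide h s₁ s₂ hh hs₁N hs₂h (by omega)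
    -- `n ≤ C(a,4) ≤ Σ_{i<5} C(a,i)` and `n ≤ 2^a`
    have hdesc : (s₂ - 4) ^ 4 ≤ 24 * a.choose 4 := by
      have h1 := Nat.pow_sub_le_descFactorial a 4
      rw [Nat.descFactorial_eq_factorial_mul_choose, show Nat.factorial 4 = 24 by rfl,
        show a + 1 - 4 = s₂ - 4 by omega] at h1
      exact h1
    have hnC4 : n ≤ a.choose 4 := by
      have : 24 * n ≤ 24 * a.choose 4 := by rw [hn]; exact hwide.trans hdesc
      omega
    have hn2a : n ≤ 2 ^ a := hnC4.trans (Nat.choose_le_two_pow a 4)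
    have hnC : n ≤ ∑ i ∈ Finset.range 5, a.choose i :=
      hnC4.trans (Finset.single_le_sum (f := fun i => a.choose i) (fun i _ => Nat.zero_le _)
        (Finset.mem_range.mpr (by norm_num : 4 < 5)))
    -- the rows: small subsets of the first `a` coordinates
    let emb : Fin a ↪ Fin h := Fin.castLEEmb ha
    set A : Finset (Fin h) := (Finset.univ : Finset (Fin a)).map emb with hA
    have hAcard : A.card = a := by simp [hA]
    let v : Fin n → Finset (Fin h) := fun i => (rowsSmallFirst a 5 n hn2a i).map emb
    have hv : Function.Injective v := by
      intro i i' hii'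
      exact rowsSmallFirst_injective a 5 n hn2a ((Finset.map_injective emb) hii')
    refine ⟨v, hv, fun T => ?_⟩
    refine det_eq_zero_of_two_slots_levels_rank h 2 1 1 D N n A v S e he hlive 0 f₁ f₂ hf ?_ T
    -- every row is small and inside `A`
    have hall : ∀ i, (rowsSmallFirst a 5 n hn2a i).card < 5 := by
      have hsmall := card_small_rowsSmallFirst a 5 n hn2a
      rw [min_eq_left hnC] at hsmall
      have heq : (Finset.univ.filter fun i : Fin n => (rowsSmallFirst a 5 n hn2a i).card < 5) = Finset.univ :=
        Finset.eq_univ_of_card _ (le_antisymm (Finset.card_filter_le _ _ |>.trans (by simp)) (by simpa using hsmall))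
      intro i
      have : i ∈ (Finset.univ.filter fun i : Fin n => (rowsSmallFirst a 5 n hn2a i).card < 5) := by
        rw [heq]; exact Finset.mem_univ i
      exact (Finset.mem_filter.mp this).2
    have hSmall : (Finset.univ.filter fun i : Fin n => v i ⊆ A ∧ (v i).card ≤ 2 + 1 + 1) = Finset.univ := by
      refine Finset.eq_univ_of_forall fun i => Finset.mem_filter.mpr ⟨Finset.mem_univ _, ?_, ?_⟩
      · exact Finset.map_subset_map.mpr (Finset.subset_univ _)
      · have := hall i
        simp only [v, Finset.card_map]
        omega
    rw [hSmall, Finset.card_univ, Fintype.card_fin, hAcard]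
    -- the deficit is positive
    have hx₁ : 1 ≤ s₁ + 1 - ∑ i ∈ Finset.range 3, a.choose i := by
      have hmono : ∑ i ∈ Finset.range 3, a.choose i ≤ ∑ i ∈ Finset.range 3, h.choose i :=
        Finset.sum_le_sum fun i _ => Nat.choose_le_choose i ha
      omega
    have hx₂ : 1 ≤ s₂ + 1 - ∑ i ∈ Finset.range 2, a.choose i := by
      simp only [Finset.sum_range_succ, Finset.sum_range_zero, Nat.choose_zero_right, Nat.choose_one_right, zero_add]
      omega
    have := Nat.mul_le_mul hx₁ hx₂
    show n < n + (s₁ + 1 - ∑ i ∈ Finset.range 3, a.choose i) * (s₂ + 1 - ∑ i ∈ Finset.range 2, a.choose i)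
    omega

end Summit.ValiantsHypothesis.ValiantsHypothesis.Theorems.BarrierLever.SimplexJoin
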